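import Mathlib.AlgebraicGeometry.Pullbacks
import Mathlib.AlgebraicGeometry.Morphisms.FiniteType
import Mathlib.RingTheory.TensorProduct.Quotient
import Mathlib.RingTheory.TensorProduct.MvPolynomial
import Mathlib.RingTheory.MvPolynomial.Basic
import HarnessLib

/-!
# [OURS · L1 W8.2] Base change of a hypersurface `Spec K[X]/(f)` along a ring map of fields

Cell `res-hironaka` (run/shared/lean/pub/res-hironaka/), LADDER-RESOLUTION rung L (RESCUE), slot W8.2 of
plan/RESCUE-SEED.md, door 2 = route `UniformComplexity`, host item `PrimeModelTransfer`
(stmt-ResolutionOfSingularities-8933); prover res-L1-s82-pv-2 (gen 4). THESES-FREE support module (Mathlib +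
`HarnessLib` only), the generic form of the gen-3 bookkeeping `TwistExponent.tensorEquiv` / `pullbackTwistCurveIso`
(Theorems/UniformComplexityCampaignW82TwistExponentNormalization.lean / …BaseChange.lean): for ANY index type `σ`,
any field `K`, any `f ∈ K[X_σ]` and any ring map of fields `φ : K → L`,

* `specIsoOfRingEquiv e : Spec A ≅ Spec B` for a ring isomorphism `e : A ≃ B`, kept in `Spec.map` form, and
  `specIsoOfRingEquiv_hom_comp` (over `Spec K` when `e` is `K`-linear on constants);
* `hypTensorEquivL` / `hypTensorEquiv`: `K[X]/(f) ⊗_K L ≅ L[X]/(f^L)` (Mathlib's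
  `Algebra.TensorProduct.tensorQuotientEquiv` + `MvPolynomial.algebraTensorAlgEquiv`), `hypBaseChangeHom`;
* **`pullbackHypIso φ : Spec K[X]/(f) ×_{Spec K, φ} Spec L ≅ Spec L[X]/(φ f)`**, lying over `Spec L`
  (`pullbackHypIso_hom_comp`); `locallyOfFiniteType_hypTo`.

Consumed by Theorems/UniformComplexityCampaignW82TwistNormal.lean (Frobenius twists and perfect base change of the
surface `x^p − t = yz`). [OURS] support; replaces the role of no printed item; NOT a statement of H. Hironaka's
manuscript [Hironaka2017]; nothing attributed to its author. No `sorry`, no new axioms. AI work, weaker than expert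
review.

## References (locators only)
* The Stacks Project, Tag 01JY (base change of affine schemes is `Spec` of the tensor product). [StacksProject]
-/

noncomputable section

set_option linter.dupNamespace false -- mandated namespace of this single-conjunct summit

open TensorProduct
open _root_.CategoryTheory _root_.CategoryTheory.Limits _root_.AlgebraicGeometry

namespace Summit.ResolutionOfSingularities.ResolutionOfSingularities.Theorems.CampaignW82.TwistNormal

/-! ## §6 Base change of a hypersurface quotient `K[X]/(f)` along a ring map of fields `φ : K → L` -/

section HypBaseChange

variable (K : Type) [Field K] {σ : Type} (f : MvPolynomial σ K) (L : Type) [Field L]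

/-- `Spec` of a ring isomorphism `e : A ≃ B`, as an isomorphism `Spec A ≅ Spec B` (kept in `Spec.map` form).
[folklore] -/
def specIsoOfRingEquiv {A B : Type} [CommRing A] [CommRing B] (e : A ≃+* B) : Spec (.of A) ≅ Spec (.of B) where
  hom := Spec.map (CommRingCat.ofHom e.symm.toRingHom)
  inv := Spec.map (CommRingCat.ofHom e.toRingHom)
  hom_inv_id := by
    rw [← Spec.map_comp, ← Spec.map_id]
    congr 1
    ext x
    exact e.symm_apply_apply x
  inv_hom_id := by
    rw [← Spec.map_comp, ← Spec.map_id]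
    congr 1
    ext x
    exact e.apply_symm_apply x

/-- For `K`-algebras `A`, `B` and a ring isomorphism `e : A ≃ B` over `K`, `Spec A ≅ Spec B` lies over `Spec K`.
[folklore] -/
theorem specIsoOfRingEquiv_hom_comp {K A B : Type} [CommRing K] [CommRing A] [CommRing B] [Algebra K A]
    [Algebra K B] (e : A ≃+* B) (he : ∀ k, e (algebraMap K A k) = algebraMap K B k) :
    (specIsoOfRingEquiv e).hom ≫ Spec.map (CommRingCat.ofHom (algebraMap K B)) =
      Spec.map (CommRingCat.ofHom (algebraMap K A)) := by
  show Spec.map _ ≫ Spec.map _ = _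
  rw [← Spec.map_comp]
  congr 1
  ext k
  change e.symm (algebraMap K B k) = algebraMap K A k
  rw [RingEquiv.symm_apply_eq, he]

/-- The hypersurface ring `K[X_σ]/(f)`. [folklore] -/
abbrev HypRing : Type := MvPolynomial σ K ⧸ Ideal.span {f}

/-- `Spec K[X]/(f)`. [folklore] -/
abbrev hypSpec : Scheme.{0} := Spec (.of (HypRing K f))

/-- Its structure morphism to `Spec K`. [folklore] -/
abbrev hypTo : hypSpec K f ⟶ Spec (.of K) :=
  Spec.map (CommRingCat.ofHom (algebraMap K (HypRing K f)))

/-- **`L ⊗_K K[X]/(f) ≅ L[X]/(f^L)`** (Mathlib's `Algebra.TensorProduct.tensorQuotientEquiv` with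
`MvPolynomial.algebraTensorAlgEquiv`). [folklore] -/
def hypTensorEquivL [Algebra K L] :
    L ⊗[K] HypRing K f ≃ₐ[L] HypRing L (MvPolynomial.map (algebraMap K L) f) :=
  (Algebra.TensorProduct.tensorQuotientEquiv (R := K) L (MvPolynomial σ K) L (Ideal.span {f})).trans
    (Ideal.quotientEquivAlg _ _ (MvPolynomial.algebraTensorAlgEquiv K L) (by
      rw [Ideal.map_span, Set.image_singleton, Ideal.map_span, Set.image_singleton]
      congr 1
      ext1
      simp [Algebra.TensorProduct.includeRight_apply]))

/-- The base-change map `K[X]/(f) → L[X]/(f^L)`. [folklore] -/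
def hypBaseChangeHom [Algebra K L] : HypRing K f →+* HypRing L (MvPolynomial.map (algebraMap K L) f) :=
  Ideal.quotientMap (Ideal.span {MvPolynomial.map (algebraMap K L) f}) (MvPolynomial.map (algebraMap K L)) (by
    rw [← Ideal.map_le_iff_le_comap, Ideal.map_span, Set.image_singleton])

/-- Under `L ⊗_K K[X]/(f) ≅ L[X]/(f^L)`, `1 ⊗ a ↦` the base change of `a`. [folklore] -/
theorem hypTensorEquivL_one_tmul [Algebra K L] (a : HypRing K f) :
    hypTensorEquivL K f L (1 ⊗ₜ a) = hypBaseChangeHom K f L a := by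
  obtain ⟨x, rfl⟩ := Ideal.Quotient.mk_surjective a
  simp [hypTensorEquivL, hypBaseChangeHom]

/-- `K[X]/(f) ⊗_K L ≅ L[X]/(f^L)` (factors swapped, as delivered by `pullbackSpecIso`). [folklore] -/
def hypTensorEquiv [Algebra K L] : HypRing K f ⊗[K] L ≃+* HypRing L (MvPolynomial.map (algebraMap K L) f) :=
  (Algebra.TensorProduct.comm K (HypRing K f) L).toRingEquiv.trans (hypTensorEquivL K f L).toRingEquiv

/-- `a ⊗ 1 ↦` base change of `a`. [folklore] -/
theorem hypTensorEquiv_tmul_one [Algebra K L] (a : HypRing K f) :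
    hypTensorEquiv K f L (a ⊗ₜ 1) = hypBaseChangeHom K f L a := by
  rw [← hypTensorEquivL_one_tmul]
  simp [hypTensorEquiv]

/-- **Base change of `Spec K[X]/(f)` along `φ : K → L` is `Spec L[X]/(φ f)`.** [folklore] -/
def pullbackHypIso (φ : K →+* L) :
    pullback (hypTo K f) (Spec.map (CommRingCat.ofHom φ)) ≅ hypSpec L (MvPolynomial.map φ f) :=
  letI : Algebra K L := φ.toAlgebra
  pullbackSpecIso K (HypRing K f) L ≪≫ specIsoOfRingEquiv (hypTensorEquiv K f L)

/-- The base-change isomorphism lies over `Spec L`. [folklore] -/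
theorem pullbackHypIso_hom_comp (φ : K →+* L) :
    (pullbackHypIso K f L φ).hom ≫ hypTo L (MvPolynomial.map φ f) =
      pullback.snd (hypTo K f) (Spec.map (CommRingCat.ofHom φ)) := by
  letI : Algebra K L := φ.toAlgebra
  have key : (CommRingCat.ofHom (algebraMap L (HypRing L (MvPolynomial.map φ f)))) ≫
      CommRingCat.ofHom (hypTensorEquiv K f L).symm.toRingHom =
      CommRingCat.ofHom (R := L) (S := HypRing K f ⊗[K] L) (Algebra.TensorProduct.includeRight.toRingHom) := by
    ext l
    change (hypTensorEquiv K f L).symm (algebraMap L (HypRing L (MvPolynomial.map φ f)) l) =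
      (1 : HypRing K f) ⊗ₜ[K] l
    apply (hypTensorEquiv K f L).injective
    rw [RingEquiv.apply_symm_apply]
    change _ = hypTensorEquivL K f L ((Algebra.TensorProduct.comm K (HypRing K f) L) (1 ⊗ₜ l))
    have h0 : ∀ x : L, x ⊗ₜ[K] (1 : HypRing K f) = x • ((1 : L) ⊗ₜ[K] (1 : HypRing K f)) :=
      fun x => by rw [TensorProduct.smul_tmul', smul_eq_mul, mul_one]
    rw [Algebra.TensorProduct.comm_tmul, h0, map_smul, ← Algebra.TensorProduct.one_def, map_one,
      ← Algebra.algebraMap_eq_smul_one]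
    rfl
  show ((pullbackSpecIso K (HypRing K f) L).hom ≫ Spec.map _) ≫ Spec.map _ = _
  rw [Category.assoc, ← Spec.map_comp, key]
  exact pullbackSpecIso_hom_snd K (HypRing K f) L

/-- `Spec K[X_σ]/(f) → Spec K` is locally of finite type for finite `σ`. [folklore] -/
theorem locallyOfFiniteType_hypTo [Finite σ] : LocallyOfFiniteType (hypTo K f) := by
  rw [HasRingHomProperty.Spec_iff (P := @LocallyOfFiniteType), CommRingCat.hom_ofHom,
    RingHom.finiteType_algebraMap]
  infer_instance

end HypBaseChange

end Summit.ResolutionOfSingularities.ResolutionOfSingularities.Theorems.CampaignW82.TwistNormal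

end
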